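import Literature.AnabelianGeometry.SemiGraphs.SubdivisionFolding
import HarnessLib

/-!
# Finite balls in the barycentric subdivision of a semi-graph with finite stars; the two ends of an edge
# ([SemiAnbd] §1 pp. 11–13 — combinatorics for Thm 3.7 (iii) at locally finite `𝔾`)

Mochizuki, *Semi-graphs of anabelioids*, Publ. RIMS **42** (2006), §1 pp. 11–13 (semi-graphs, the associated
topological space, local finiteness) [cite: MochizukiSemiAnbd2006, §1 pp.11-13]; consumed in the proof of
Thm 3.7 (iii), manuscript p. 41 [cite: MochizukiSemiAnbd2006, Thm 3.7(iii) p.41] ("we may assume that there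
exists a compatible system of vertices of `𝒢_{∞,j}` … each of which is fixed by `H`" — at an infinite but
locally finite base the compatible choice runs through FINITE BALLS of the level trees).

PROOF-ONLY, PURE COMBINATORICS (cell abc-iut, layer L3, GAP row G-t6g3-2; seat abc-iut-L3-t8 gen 6, row
«PERSISTENT⇒VERTICIAL / ESCAPE-DICHOTOMY», brick 0; no definition, no group, no tower):

* `SemiGraph.finite_neighborSet_subdivision` — with finitely many branches at every vertex, every point of the
  barycentric subdivision has finitely many neighbours (vertex-point: its branches; edge-point: its two
  branches; branch-point: its edge and its vertex);
* `SemiGraph.finite_setOf_subdivision_dist_le`, `SemiGraph.finite_setOf_vertex_dist_le` — hence, for a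
  connected semi-graph, balls of the subdivision are finite (induction on walks of bounded length);
* `SemiGraph.exists_ends_dist_le_four'` — abc-iut-w6-d062's `exists_ends_dist_le_four` (`SubdivisionFolding.lean`)
  with the PROVENANCE of the second end recorded: it is the first end itself or the abutment of a branch of
  the edge (needed to locate its base vertex in the star of the base vertex of the first end).

Nothing here bears on [IUTchIII] Cor. 3.12.
-/

namespace Literature.AnabelianGeometry.SemiGraphs

universe u


namespace SemiGraph

variable {T : SemiGraph.{u}}

/-- In a semi-graph with finitely many branches at every vertex, every point of the barycentric subdivision
has finitely many neighbours. [cite: MochizukiSemiAnbd2006, §1 pp.11-13] -/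
theorem finite_neighborSet_subdivision (hfin : ∀ y : T.Vertex, {b : T.Branch | T.abuts b = some y}.Finite)
    (x : T.Node) : (T.subdivision.neighborSet x).Finite := by
  rcases x with v | e | b
  · refine ((hfin v).image fun b => (Sum.inr (Sum.inr b) : T.Node)).subset ?_
    intro z hz
    obtain ⟨b, hb, rfl⟩ := (T.subdivision_adj_inl_iff v z).1 hz
    exact ⟨b, hb, rfl⟩
  · obtain ⟨b₁, b₂, -, -, -, hall⟩ := T.two_branches e
    refine ((Set.finite_singleton (Sum.inr (Sum.inr b₂) : T.Node)).insert
      (Sum.inr (Sum.inr b₁))).subset ?_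
    intro z hz
    obtain ⟨b, hbe, rfl⟩ := (T.subdivision_adj_edge_iff e z).1 hz
    rcases hall b hbe with rfl | rfl
    · exact Set.mem_insert _ _
    · exact Set.mem_insert_of_mem _ rfl
  · have hsub : {w : T.Vertex | T.abuts b = some w}.Subsingleton := fun w hw w' hw' =>
      Option.some.inj (hw.symm.trans hw')
    refine (((hsub.finite).image fun w => (Sum.inl w : T.Node)).insert
      (Sum.inr (Sum.inl (T.edgeOf b)))).subset ?_
    intro z hz
    rcases (T.subdivision_adj_branch_iff b z).1 hz with rfl | ⟨w, hw, rfl⟩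
    · exact Set.mem_insert _ _
    · exact Set.mem_insert_of_mem _ ⟨w, hw, rfl⟩

/-- The points of the subdivision from which a fixed point is reached by a walk of length `≤ n` form a
finite set (finite stars). [cite: MochizukiSemiAnbd2006, §1 pp.11-13] -/
private theorem finite_setOf_exists_walk_length_le
    (hfin : ∀ y : T.Vertex, {b : T.Branch | T.abuts b = some y}.Finite) (x : T.Node) (n : ℕ) :
    {z : T.Node | ∃ w : T.subdivision.Walk z x, w.length ≤ n}.Finite := by
  induction n with
  | zero =>
    refine (Set.finite_singleton x).subset ?_
    rintro z ⟨w, hw⟩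
    exact SimpleGraph.Walk.eq_of_length_eq_zero (Nat.le_zero.mp hw)
  | succ n ih =>
    refine ((ih.biUnion fun y _ => finite_neighborSet_subdivision hfin y).union
      (Set.finite_singleton x)).subset ?_
    rintro z ⟨w, hw⟩
    cases w with
    | nil => exact Or.inr rfl
    | cons h w' =>
      refine Or.inl (Set.mem_biUnion (x := _) ⟨w', ?_⟩ ?_)
      · rw [SimpleGraph.Walk.length_cons] at hw
        omega
      · exact h.symm

/-- **Balls of the subdivision are finite** when every vertex has finitely many branches and the semi-graph
is connected. [cite: MochizukiSemiAnbd2006, §1 pp.11-13] -/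
theorem finite_setOf_subdivision_dist_le (hconn : T.subdivision.Connected)
    (hfin : ∀ y : T.Vertex, {b : T.Branch | T.abuts b = some y}.Finite) (x : T.Node) (n : ℕ) :
    {z : T.Node | T.subdivision.dist x z ≤ n}.Finite :=
  (finite_setOf_exists_walk_length_le hfin x n).subset fun z hz => by
    obtain ⟨w, hw⟩ := hconn.exists_walk_length_eq_dist z x
    refine ⟨w, ?_⟩
    rw [hw, SimpleGraph.dist_comm]
    exact hz

/-- The vertices within subdivision distance `n` of a vertex form a finite set (finite stars, connected).
[cite: MochizukiSemiAnbd2006, §1 pp.11-13] -/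
theorem finite_setOf_vertex_dist_le (hconn : T.subdivision.Connected)
    (hfin : ∀ y : T.Vertex, {b : T.Branch | T.abuts b = some y}.Finite) (a : T.Vertex) (n : ℕ) :
    {z : T.Vertex | T.subdivision.dist (Sum.inl a) (Sum.inl z) ≤ n}.Finite :=
  (finite_setOf_subdivision_dist_le hconn hfin (Sum.inl a) n).preimage Sum.inl_injective.injOn

/-- **The two ends of an edge, with provenance** (variant of abc-iut-w6-d062's
`exists_ends_dist_le_four`): for an edge `ε` with a branch `c₀` abutting to `a` there is a vertex `a'` with
every abutting vertex of `ε` in `{a, a'}`, `dist (a, a') ≤ 4` in the subdivision, AND `a' = a` or `a'` is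
the abutment of a branch of `ε`. [cite: MochizukiSemiAnbd2006, §1 pp.11-12] -/
theorem exists_ends_dist_le_four' (ε : T.Edge) {a : T.Vertex} (c₀ : T.Branch)
    (hc₀ε : T.edgeOf c₀ = ε) (hc₀a : T.abuts c₀ = some a) :
    ∃ a' : T.Vertex,
      (∀ (c : T.Branch) (w : T.Vertex), T.edgeOf c = ε → T.abuts c = some w → w = a ∨ w = a') ∧
      T.subdivision.dist (Sum.inl a) (Sum.inl a') ≤ 4 ∧
      (a' = a ∨ ∃ c : T.Branch, T.edgeOf c = ε ∧ T.abuts c = some a') := by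
  obtain ⟨b₁, b₂, hne, hb₁, hb₂, hall⟩ := T.two_branches ε
  -- the branch `c` of `ε` other than `c₀`
  obtain ⟨c, hcε, hcall⟩ : ∃ c : T.Branch, T.edgeOf c = ε ∧
      ∀ d : T.Branch, T.edgeOf d = ε → d = c₀ ∨ d = c := by
    rcases hall c₀ hc₀ε with h | h
    · exact ⟨b₂, hb₂, fun d hd => by
        rcases hall d hd with h' | h'
        · exact Or.inl (h'.trans h.symm)
        · exact Or.inr h'⟩
    · exact ⟨b₁, hb₁, fun d hd => by
        rcases hall d hd with h' | h'
        · exact Or.inr h'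
        · exact Or.inl (h'.trans h.symm)⟩
  have hA1 : T.subdivision.Adj (Sum.inl a) (Sum.inr (Sum.inr c₀)) :=
    (T.subdivision_adj_inl_iff a _).2 ⟨c₀, hc₀a, rfl⟩
  have hA2 : T.subdivision.Adj (Sum.inr (Sum.inr c₀)) (Sum.inr (Sum.inl ε)) :=
    (T.subdivision_adj_branch_iff c₀ _).2 (Or.inl (by rw [hc₀ε]))
  have hA3 : T.subdivision.Adj (Sum.inr (Sum.inl ε)) (Sum.inr (Sum.inr c)) :=
    (T.subdivision_adj_edge_iff ε _).2 ⟨c, hcε, rfl⟩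
  cases hca : T.abuts c with
  | none =>
    refine ⟨a, fun d w hd hw => ?_, by simp, Or.inl rfl⟩
    rcases hcall d hd with rfl | rfl
    · exact Or.inl (Option.some.inj (hw.symm.trans hc₀a))
    · rw [hca] at hw; cases hw
  | some a' =>
    refine ⟨a', fun d w hd hw => ?_, ?_, Or.inr ⟨c, hcε, hca⟩⟩
    · rcases hcall d hd with rfl | rfl
      · exact Or.inl (Option.some.inj (hw.symm.trans hc₀a))
      · exact Or.inr (Option.some.inj (hw.symm.trans hca))
    · have hA4 : T.subdivision.Adj (Sum.inr (Sum.inr c)) (Sum.inl a') :=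
        (T.subdivision_adj_branch_iff c _).2 (Or.inr ⟨a', hca, rfl⟩)
      let w : T.subdivision.Walk (Sum.inl a) (Sum.inl a') :=
        SimpleGraph.Walk.cons hA1 (SimpleGraph.Walk.cons hA2
          (SimpleGraph.Walk.cons hA3 (SimpleGraph.Walk.cons hA4 SimpleGraph.Walk.nil)))
      have hw : w.length = 4 := rfl
      exact hw ▸ SimpleGraph.dist_le w

end SemiGraph

end Literature.AnabelianGeometry.SemiGraphs
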